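import Summits.Ventures.Crystal3D.Theorems.StickyWulffConstantGenericWallFloorUpperNeighbourCubic
import HarnessLib

/-!
# The upper-neighbour lemma for the checkerboard lattice `D₃`, ONE `(111)` BILAYER AT A TIME
# (lane T, the T-side port of lane G's walker ledger — Barlow sealing, cubic core; crux `TextureLiminf`, stmt-Ventures-19483)

HONEST FRAMING. Venture `Summits/Ventures/Crystal3D` (cell `crystal3d-full`), helper `--supports` the crux
`TextureLiminf` (stmt-Ventures-19483) of `route-Ventures-StickyWulffConstant`, registered line `TexShadow` (v6.5; cf-p1
ROUTE.md §86(23) R / §86(26) U: the wall stubs conclude `BilayerWallAt` for clamped plates of an arbitrary moved Hägg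
stacking; the T-side port of lane G's walker ledger = Barlow sealing + inner-face bookkeeping + flux count).  Rung credit
only; F-C1 not moved.  This file is the pure real-arithmetic core of BARLOW SEALING (`…TextureLiminfBarlowSealing`):
lane G's `D3_exists_near_ge` (`…GenericWallFloorUpperNeighbourCubic`) finds, for a non-lattice point `X` and a linear
functional `λ`, a point `V ∈ D₃ = {(a,b,c) ∈ ℤ³ : a+b+c even}` with `|X − V|² < 2` and `λ(V) ≥ λ(X)` — anywhere in the
lattice.  A Barlow stacking agrees with (a moved copy of) the fcc lattice only two consecutive close-packed layers at a
time, so the transfer to Barlow stackings needs the neighbour IN THE BILAYER whose closed slab contains `X`: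

* `octant100/010/001/111_exists_near_ge_layer`, `tetra_exists_near_ge_layer` — the cell lemmas of the fcc file with the
  layer `a+b+c` of the returned vertex recorded (`{0,2}` for the tetrahedron `000,110,101,011` and the octahedra at the odd
  corners `100, 010, 001`; `{2,4}` for the octahedron at `111`);
* `face_exists_near_ge_layer` — the shared triangular face `{x+y+z = 2} ∩ [0,1]³ = conv{011,101,110}` (points ON the
  middle layer plane must be served inside that layer);
* `cube_bilayer_exists_near_ge` — the unit cube: a non-lattice point with `2k ≤ x+y+z ≤ 2k+2` is served by a vertex with
  `a+b+c ∈ {2k, 2k+2}`;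
* **`D3_bilayer_exists_near_ge`** — all of `ℝ³`, reducing to the cube by the bilayer-respecting symmetries of `D₃`
  (translations, and the point reflections `X ↦ n + (1,1,1) − X` for `Σ n` odd);
  `D3_bilayer_exists_near_ge'` — the same for the layer functional `−a+b+c` of the tree's cubic frame
  (`cubic_barlowPos`: the site `(k,i,j)` of `Λ₀` has cubic coordinates `(i+j, i+k, j+k)`).
WHAT THIS IS NOT: nothing about packings or the cell inequality; F-C1 not moved.
-/

namespace Summit.Ventures.Crystal3D.Theorems

/-! ## The checkerboard lattice `D₃`, one `(111)` bilayer at a time -/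

/-- The octant at the odd corner `100` of the unit cube; the six vertices of its octahedron lie in the layers
`a+b+c ∈ {0, 2}`. -/
theorem octant100_exists_near_ge_layer (x y z l₁ l₂ l₃ : ℝ) (hx : x ≤ 1) (hy : 0 ≤ y) (hz : 0 ≤ z)
    (hoct : y + z ≤ x)
    (hD : ∀ a b c : ℤ, Even (a + b + c) → ¬((a : ℝ) = x ∧ (b : ℝ) = y ∧ (c : ℝ) = z)) :
    ∃ a b c : ℤ, Even (a + b + c) ∧ (a + b + c = 0 ∨ a + b + c = 2) ∧
      (x - a) ^ 2 + (y - b) ^ 2 + (z - c) ^ 2 < 2 ∧ l₁ * x + l₂ * y + l₃ * z ≤ l₁ * a + l₂ * b + l₃ * c := by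
  have hS := octant_sq_lt_one (1 - x) y z (by linarith) hy hz (by linarith)
    (fun h => hD 0 0 0 (by decide) ⟨by push_cast; linarith, by push_cast; linarith, by push_cast; linarith⟩)
    (fun h => hD 1 1 0 (by decide) ⟨by push_cast; linarith, by push_cast; linarith, by push_cast; linarith⟩)
    (fun h => hD 1 0 1 (by decide) ⟨by push_cast; linarith, by push_cast; linarith, by push_cast; linarith⟩)
  rcases octant_core (1 - x) y z (-l₁) l₂ l₃ (by linarith) hy hz (by linarith) hS with
    ⟨hd, hl⟩ | ⟨hd, hl⟩ | ⟨hd, hl⟩ | ⟨hd, hl⟩ | ⟨hd, hl⟩ | ⟨hd, hl⟩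
  · exact ⟨0, 0, 0, by decide, by norm_num, by push_cast; nlinarith, by push_cast; linarith⟩
  · exact ⟨1, 1, 0, by decide, by norm_num, by push_cast; nlinarith, by push_cast; linarith⟩
  · exact ⟨1, 0, 1, by decide, by norm_num, by push_cast; nlinarith, by push_cast; linarith⟩
  · exact ⟨2, 0, 0, by decide, by norm_num, by push_cast; nlinarith, by push_cast; linarith⟩
  · exact ⟨1, (-1), 0, by decide, by norm_num, by push_cast; nlinarith, by push_cast; linarith⟩
  · exact ⟨1, 0, (-1), by decide, by norm_num, by push_cast; nlinarith, by push_cast; linarith⟩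

/-- The octant at the odd corner `010`; vertices in the layers `a+b+c ∈ {0, 2}`. -/
theorem octant010_exists_near_ge_layer (x y z l₁ l₂ l₃ : ℝ) (hy : y ≤ 1) (hx : 0 ≤ x) (hz : 0 ≤ z)
    (hoct : x + z ≤ y)
    (hD : ∀ a b c : ℤ, Even (a + b + c) → ¬((a : ℝ) = x ∧ (b : ℝ) = y ∧ (c : ℝ) = z)) :
    ∃ a b c : ℤ, Even (a + b + c) ∧ (a + b + c = 0 ∨ a + b + c = 2) ∧
      (x - a) ^ 2 + (y - b) ^ 2 + (z - c) ^ 2 < 2 ∧ l₁ * x + l₂ * y + l₃ * z ≤ l₁ * a + l₂ * b + l₃ * c := by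
  have hS := octant_sq_lt_one x (1 - y) z hx (by linarith) hz (by linarith)
    (fun h => hD 1 1 0 (by decide) ⟨by push_cast; linarith, by push_cast; linarith, by push_cast; linarith⟩)
    (fun h => hD 0 0 0 (by decide) ⟨by push_cast; linarith, by push_cast; linarith, by push_cast; linarith⟩)
    (fun h => hD 0 1 1 (by decide) ⟨by push_cast; linarith, by push_cast; linarith, by push_cast; linarith⟩)
  rcases octant_core x (1 - y) z l₁ (-l₂) l₃ hx (by linarith) hz (by linarith) hS with
    ⟨hd, hl⟩ | ⟨hd, hl⟩ | ⟨hd, hl⟩ | ⟨hd, hl⟩ | ⟨hd, hl⟩ | ⟨hd, hl⟩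
  · exact ⟨1, 1, 0, by decide, by norm_num, by push_cast; nlinarith, by push_cast; linarith⟩
  · exact ⟨0, 0, 0, by decide, by norm_num, by push_cast; nlinarith, by push_cast; linarith⟩
  · exact ⟨0, 1, 1, by decide, by norm_num, by push_cast; nlinarith, by push_cast; linarith⟩
  · exact ⟨(-1), 1, 0, by decide, by norm_num, by push_cast; nlinarith, by push_cast; linarith⟩
  · exact ⟨0, 2, 0, by decide, by norm_num, by push_cast; nlinarith, by push_cast; linarith⟩
  · exact ⟨0, 1, (-1), by decide, by norm_num, by push_cast; nlinarith, by push_cast; linarith⟩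

/-- The octant at the odd corner `001`; vertices in the layers `a+b+c ∈ {0, 2}`. -/
theorem octant001_exists_near_ge_layer (x y z l₁ l₂ l₃ : ℝ) (hz : z ≤ 1) (hx : 0 ≤ x) (hy : 0 ≤ y)
    (hoct : x + y ≤ z)
    (hD : ∀ a b c : ℤ, Even (a + b + c) → ¬((a : ℝ) = x ∧ (b : ℝ) = y ∧ (c : ℝ) = z)) :
    ∃ a b c : ℤ, Even (a + b + c) ∧ (a + b + c = 0 ∨ a + b + c = 2) ∧
      (x - a) ^ 2 + (y - b) ^ 2 + (z - c) ^ 2 < 2 ∧ l₁ * x + l₂ * y + l₃ * z ≤ l₁ * a + l₂ * b + l₃ * c := by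
  have hS := octant_sq_lt_one x y (1 - z) hx hy (by linarith) (by linarith)
    (fun h => hD 1 0 1 (by decide) ⟨by push_cast; linarith, by push_cast; linarith, by push_cast; linarith⟩)
    (fun h => hD 0 1 1 (by decide) ⟨by push_cast; linarith, by push_cast; linarith, by push_cast; linarith⟩)
    (fun h => hD 0 0 0 (by decide) ⟨by push_cast; linarith, by push_cast; linarith, by push_cast; linarith⟩)
  rcases octant_core x y (1 - z) l₁ l₂ (-l₃) hx hy (by linarith) (by linarith) hS with
    ⟨hd, hl⟩ | ⟨hd, hl⟩ | ⟨hd, hl⟩ | ⟨hd, hl⟩ | ⟨hd, hl⟩ | ⟨hd, hl⟩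
  · exact ⟨1, 0, 1, by decide, by norm_num, by push_cast; nlinarith, by push_cast; linarith⟩
  · exact ⟨0, 1, 1, by decide, by norm_num, by push_cast; nlinarith, by push_cast; linarith⟩
  · exact ⟨0, 0, 0, by decide, by norm_num, by push_cast; nlinarith, by push_cast; linarith⟩
  · exact ⟨(-1), 0, 1, by decide, by norm_num, by push_cast; nlinarith, by push_cast; linarith⟩
  · exact ⟨0, (-1), 1, by decide, by norm_num, by push_cast; nlinarith, by push_cast; linarith⟩
  · exact ⟨0, 0, 2, by decide, by norm_num, by push_cast; nlinarith, by push_cast; linarith⟩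

/-- The octant at the odd corner `111` (`x+y+z ≥ 2`); vertices in the layers `a+b+c ∈ {2, 4}`. -/
theorem octant111_exists_near_ge_layer (x y z l₁ l₂ l₃ : ℝ) (hx : x ≤ 1) (hy : y ≤ 1) (hz : z ≤ 1)
    (hoct : 2 ≤ x + y + z)
    (hD : ∀ a b c : ℤ, Even (a + b + c) → ¬((a : ℝ) = x ∧ (b : ℝ) = y ∧ (c : ℝ) = z)) :
    ∃ a b c : ℤ, Even (a + b + c) ∧ (a + b + c = 2 ∨ a + b + c = 4) ∧
      (x - a) ^ 2 + (y - b) ^ 2 + (z - c) ^ 2 < 2 ∧ l₁ * x + l₂ * y + l₃ * z ≤ l₁ * a + l₂ * b + l₃ * c := by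
  have hS := octant_sq_lt_one (1 - x) (1 - y) (1 - z) (by linarith) (by linarith) (by linarith) (by linarith)
    (fun h => hD 0 1 1 (by decide) ⟨by push_cast; linarith, by push_cast; linarith, by push_cast; linarith⟩)
    (fun h => hD 1 0 1 (by decide) ⟨by push_cast; linarith, by push_cast; linarith, by push_cast; linarith⟩)
    (fun h => hD 1 1 0 (by decide) ⟨by push_cast; linarith, by push_cast; linarith, by push_cast; linarith⟩)
  rcases octant_core (1 - x) (1 - y) (1 - z) (-l₁) (-l₂) (-l₃) (by linarith) (by linarith) (by linarith)
    (by linarith) hS with ⟨hd, hl⟩ | ⟨hd, hl⟩ | ⟨hd, hl⟩ | ⟨hd, hl⟩ | ⟨hd, hl⟩ | ⟨hd, hl⟩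
  · exact ⟨0, 1, 1, by decide, by norm_num, by push_cast; nlinarith, by push_cast; linarith⟩
  · exact ⟨1, 0, 1, by decide, by norm_num, by push_cast; nlinarith, by push_cast; linarith⟩
  · exact ⟨1, 1, 0, by decide, by norm_num, by push_cast; nlinarith, by push_cast; linarith⟩
  · exact ⟨2, 1, 1, by decide, by norm_num, by push_cast; nlinarith, by push_cast; linarith⟩
  · exact ⟨1, 2, 1, by decide, by norm_num, by push_cast; nlinarith, by push_cast; linarith⟩
  · exact ⟨1, 1, 2, by decide, by norm_num, by push_cast; nlinarith, by push_cast; linarith⟩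

/-- The tetrahedron `conv{000, 110, 101, 011}` (strict version); vertices in the layers `a+b+c ∈ {0, 2}`. -/
theorem tetra_exists_near_ge_layer (x y z l₁ l₂ l₃ : ℝ) (h1 : x < y + z) (h2 : y < x + z)
    (h3 : z < x + y) (h4 : x + y + z < 2) :
    ∃ a b c : ℤ, Even (a + b + c) ∧ (a + b + c = 0 ∨ a + b + c = 2) ∧
      (x - a) ^ 2 + (y - b) ^ 2 + (z - c) ^ 2 < 2 ∧ l₁ * x + l₂ * y + l₃ * z ≤ l₁ * a + l₂ * b + l₃ * c := by
  have := exists_ge_of_convex4 (1 - (x + y + z) / 2) ((x + y - z) / 2) ((x - y + z) / 2)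
    ((-x + y + z) / 2) 0 (l₁ + l₂) (l₁ + l₃) (l₂ + l₃) (by linarith) (by linarith) (by linarith)
    (by linarith) (by ring)
  have hval : (1 - (x + y + z) / 2) * 0 + (x + y - z) / 2 * (l₁ + l₂) +
      (x - y + z) / 2 * (l₁ + l₃) + (-x + y + z) / 2 * (l₂ + l₃) = l₁ * x + l₂ * y + l₃ * z := by ring
  rw [hval] at this
  rcases this with h | h | h | h
  · refine ⟨0, 0, 0, by decide, by norm_num, ?_, by push_cast; linarith⟩
    push_cast
    have := tetra_near_origin x y z h1.le h2.le h3.le h4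
    nlinarith
  · refine ⟨1, 1, 0, by decide, by norm_num, ?_, by push_cast; linarith⟩
    push_cast
    have := tetra_near_origin (1 - x) (1 - y) z (by linarith) (by linarith) (by linarith) (by linarith)
    nlinarith
  · refine ⟨1, 0, 1, by decide, by norm_num, ?_, by push_cast; linarith⟩
    push_cast
    have := tetra_near_origin (1 - x) y (1 - z) (by linarith) (by linarith) (by linarith) (by linarith)
    nlinarith
  · refine ⟨0, 1, 1, by decide, by norm_num, ?_, by push_cast; linarith⟩
    push_cast
    have := tetra_near_origin x (1 - y) (1 - z) (by linarith) (by linarith) (by linarith) (by linarith)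
    nlinarith

/-- Nearness on the shared triangular face `x+y+z = 2` of the unit cube: the vertex `011` is at squared distance
`< 2` from every face point other than the two other vertices (`y ≠ 0`, `z ≠ 0`). -/
theorem face_near_aux (x y z : ℝ) (hx : x ≤ 1) (hy : y ≤ 1) (hz : z ≤ 1) (hs : x + y + z = 2)
    (ny : y ≠ 0) (nz : z ≠ 0) : x ^ 2 + (y - 1) ^ 2 + (z - 1) ^ 2 < 2 := by
  have hy0 : 0 ≤ y := by linarith
  have hz0 : 0 ≤ z := by linarith
  have hy' : 0 < y := lt_of_le_of_ne hy0 (Ne.symm ny)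
  have hz' : 0 < z := lt_of_le_of_ne hz0 (Ne.symm nz)
  have hxe : x = (1 - y) + (1 - z) := by linarith
  have hw : 0 < (1 - y) * z + (1 - z) * y + y * z := by nlinarith
  rw [hxe]
  nlinarith

/-- The shared triangular face `{x+y+z = 2} ∩ [0,1]³ = conv{011, 101, 110}` (a face of the tetrahedron and of the
octahedron at `111`): a non-lattice face point has a near vertex of the face (layer `a+b+c = 2`) where the functional
does not decrease. -/
theorem face_exists_near_ge_layer (x y z l₁ l₂ l₃ : ℝ) (hx : x ≤ 1) (hy : y ≤ 1) (hz : z ≤ 1)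
    (hs : x + y + z = 2)
    (hD : ∀ a b c : ℤ, Even (a + b + c) → ¬((a : ℝ) = x ∧ (b : ℝ) = y ∧ (c : ℝ) = z)) :
    ∃ a b c : ℤ, Even (a + b + c) ∧ a + b + c = 2 ∧
      (x - a) ^ 2 + (y - b) ^ 2 + (z - c) ^ 2 < 2 ∧ l₁ * x + l₂ * y + l₃ * z ≤ l₁ * a + l₂ * b + l₃ * c := by
  -- no coordinate vanishes (else the point is one of the three vertices)
  have nx : x ≠ 0 := fun h =>
    hD 0 1 1 (by decide) ⟨by push_cast; linarith, by push_cast; linarith, by push_cast; linarith⟩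
  have ny : y ≠ 0 := fun h =>
    hD 1 0 1 (by decide) ⟨by push_cast; linarith, by push_cast; linarith, by push_cast; linarith⟩
  have nz : z ≠ 0 := fun h =>
    hD 1 1 0 (by decide) ⟨by push_cast; linarith, by push_cast; linarith, by push_cast; linarith⟩
  have := exists_ge_of_convex4 (1 - x) (1 - y) (1 - z) 0 (l₂ + l₃) (l₁ + l₃) (l₁ + l₂) (l₂ + l₃)
    (by linarith) (by linarith) (by linarith) le_rfl (by linarith)
  have hval : (1 - x) * (l₂ + l₃) + (1 - y) * (l₁ + l₃) + (1 - z) * (l₁ + l₂) + 0 * (l₂ + l₃) =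
      l₁ * x + l₂ * y + l₃ * z := by
    have hxe : x = 2 - y - z := by linarith
    rw [hxe]; ring
  rw [hval] at this
  rcases this with h | h | h | h
  · refine ⟨0, 1, 1, by decide, by norm_num, ?_, by push_cast; linarith⟩
    push_cast
    have := face_near_aux x y z hx hy hz hs ny nz
    nlinarith
  · refine ⟨1, 0, 1, by decide, by norm_num, ?_, by push_cast; linarith⟩
    push_cast
    have := face_near_aux y x z hy hx hz (by linarith) nx nz
    nlinarith
  · refine ⟨1, 1, 0, by decide, by norm_num, ?_, by push_cast; linarith⟩
    push_cast
    have := face_near_aux z x y hz hx hy (by linarith) nx ny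
    nlinarith
  · refine ⟨0, 1, 1, by decide, by norm_num, ?_, by push_cast; linarith⟩
    push_cast
    have := face_near_aux x y z hx hy hz hs ny nz
    nlinarith

/-- **The unit cube, one bilayer at a time.**  A non-lattice point of `[0,1]³` in the slab `2k ≤ x+y+z ≤ 2k+2` has a
near lattice point in the layers `2k`, `2k+2` where the functional does not decrease. -/
theorem cube_bilayer_exists_near_ge (x y z l₁ l₂ l₃ : ℝ) (k : ℤ) (hx0 : 0 ≤ x) (hx1 : x ≤ 1) (hy0 : 0 ≤ y)
    (hy1 : y ≤ 1) (hz0 : 0 ≤ z) (hz1 : z ≤ 1) (hlo : 2 * (k : ℝ) ≤ x + y + z) (hhi : x + y + z ≤ 2 * (k : ℝ) + 2)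
    (hD : ∀ a b c : ℤ, Even (a + b + c) → ¬((a : ℝ) = x ∧ (b : ℝ) = y ∧ (c : ℝ) = z)) :
    ∃ a b c : ℤ, Even (a + b + c) ∧ (a + b + c = 2 * k ∨ a + b + c = 2 * k + 2) ∧
      (x - a) ^ 2 + (y - b) ^ 2 + (z - c) ^ 2 < 2 ∧ l₁ * x + l₂ * y + l₃ * z ≤ l₁ * a + l₂ * b + l₃ * c := by
  rcases lt_trichotomy (x + y + z) 2 with hs | hs | hs
  · -- below the middle layer: `k = 0` (the point is not the lattice corner `000`)
    have hs0 : 0 < x + y + z := by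
      rcases lt_or_eq_of_le (by linarith : 0 ≤ x + y + z) with h | h
      · exact h
      · exact absurd ⟨by push_cast; linarith, by push_cast; linarith, by push_cast; linarith⟩
          (hD 0 0 0 (by decide))
    have hk1 : (k : ℝ) < 1 := by linarith
    have hk2 : (-1 : ℝ) < k := by linarith
    have hk : k = 0 := by
      have h1 : k < 1 := by exact_mod_cast hk1
      have h2 : -1 < k := by exact_mod_cast hk2
      omega
    subst hk
    have hconv : ∀ a b c : ℤ, (a + b + c = 0 ∨ a + b + c = 2) →
        (a + b + c = 2 * (0 : ℤ) ∨ a + b + c = 2 * (0 : ℤ) + 2) := fun a b c h => by simpa using h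
    by_cases h1 : y + z ≤ x
    · obtain ⟨a, b, c, he, hl', hd, hl⟩ := octant100_exists_near_ge_layer x y z l₁ l₂ l₃ hx1 hy0 hz0 h1 hD
      exact ⟨a, b, c, he, hconv a b c hl', hd, hl⟩
    by_cases h2 : x + z ≤ y
    · obtain ⟨a, b, c, he, hl', hd, hl⟩ := octant010_exists_near_ge_layer x y z l₁ l₂ l₃ hy1 hx0 hz0 h2 hD
      exact ⟨a, b, c, he, hconv a b c hl', hd, hl⟩
    by_cases h3 : x + y ≤ z
    · obtain ⟨a, b, c, he, hl', hd, hl⟩ := octant001_exists_near_ge_layer x y z l₁ l₂ l₃ hz1 hx0 hy0 h3 hD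
      exact ⟨a, b, c, he, hconv a b c hl', hd, hl⟩
    push Not at h1 h2 h3
    obtain ⟨a, b, c, he, hl', hd, hl⟩ := tetra_exists_near_ge_layer x y z l₁ l₂ l₃ h1 h2 h3 hs
    exact ⟨a, b, c, he, hconv a b c hl', hd, hl⟩
  · -- on the middle layer plane: the shared face; `k ∈ {0, 1}`
    obtain ⟨a, b, c, he, hl', hd, hl⟩ := face_exists_near_ge_layer x y z l₁ l₂ l₃ hx1 hy1 hz1 hs hD
    have hk1 : (k : ℝ) ≤ 1 := by linarith
    have hk2 : (0 : ℝ) ≤ k := by linarith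
    have hk : k = 0 ∨ k = 1 := by
      have h1 : k ≤ 1 := by exact_mod_cast hk1
      have h2 : 0 ≤ k := by exact_mod_cast hk2
      omega
    refine ⟨a, b, c, he, ?_, hd, hl⟩
    rcases hk with rfl | rfl
    · right; simpa using hl'
    · left; simpa using hl'
  · -- above the middle layer: `k = 1`, the octant at `111`
    have hk1 : (k : ℝ) < 2 := by linarith
    have hk2 : (0 : ℝ) < k := by linarith
    have hk : k = 1 := by
      have h1 : k < 2 := by exact_mod_cast hk1
      have h2 : 0 < k := by exact_mod_cast hk2
      omega
    subst hk
    obtain ⟨a, b, c, he, hl', hd, hl⟩ := octant111_exists_near_ge_layer x y z l₁ l₂ l₃ hx1 hy1 hz1 hs.le hD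
    refine ⟨a, b, c, he, ?_, hd, hl⟩
    rcases hl' with h | h
    · left; simpa using h
    · right; push_cast; omega

/-- **Upper-neighbour lemma for `D₃`, one bilayer at a time.**  For every `(x,y,z) ∉ D₃` with
`2k ≤ x+y+z ≤ 2k+2` and every linear functional `(l₁,l₂,l₃)` there is `(a,b,c) ∈ D₃` with `a+b+c ∈ {2k, 2k+2}`,
`(x−a)² + (y−b)² + (z−c)² < 2` and `l₁x + l₂y + l₃z ≤ l₁a + l₂b + l₃c`. -/
theorem D3_bilayer_exists_near_ge (x y z l₁ l₂ l₃ : ℝ) (k : ℤ) (hlo : 2 * (k : ℝ) ≤ x + y + z)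
    (hhi : x + y + z ≤ 2 * (k : ℝ) + 2)
    (hD : ∀ a b c : ℤ, Even (a + b + c) → ¬((a : ℝ) = x ∧ (b : ℝ) = y ∧ (c : ℝ) = z)) :
    ∃ a b c : ℤ, Even (a + b + c) ∧ (a + b + c = 2 * k ∨ a + b + c = 2 * k + 2) ∧
      (x - a) ^ 2 + (y - b) ^ 2 + (z - c) ^ 2 < 2 ∧ l₁ * x + l₂ * y + l₃ * z ≤ l₁ * a + l₂ * b + l₃ * c := by
  set n₁ := ⌊x⌋ with hn₁
  set n₂ := ⌊y⌋ with hn₂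
  set n₃ := ⌊z⌋ with hn₃
  have fx := Int.floor_le x; have fx' := Int.lt_floor_add_one x
  have fy := Int.floor_le y; have fy' := Int.lt_floor_add_one y
  have fz := Int.floor_le z; have fz' := Int.lt_floor_add_one z
  rcases Int.even_or_odd (n₁ + n₂ + n₃) with hev | hodd
  · -- translate by `-(n₁,n₂,n₃) ∈ D₃` (layers shift by `(n₁+n₂+n₃)/2`)
    obtain ⟨m, hm⟩ := hev
    have hD' : ∀ a b c : ℤ, Even (a + b + c) →
        ¬((a : ℝ) = x - n₁ ∧ (b : ℝ) = y - n₂ ∧ (c : ℝ) = z - n₃) := by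
      intro a b c he h
      refine hD (a + n₁) (b + n₂) (c + n₃) ?_ ⟨?_, ?_, ?_⟩
      · have : a + n₁ + (b + n₂) + (c + n₃) = (a + b + c) + (n₁ + n₂ + n₃) := by ring
        rw [this]; exact he.add ⟨m, hm⟩
      · push_cast; linarith [h.1]
      · push_cast; linarith [h.2.1]
      · push_cast; linarith [h.2.2]
    have hm' : ((n₁ : ℝ) + n₂ + n₃) = 2 * (m : ℝ) := by
      have : ((n₁ + n₂ + n₃ : ℤ) : ℝ) = ((m + m : ℤ) : ℝ) := by rw [hm]
      push_cast at this; linarith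
    obtain ⟨a, b, c, he, hl', hd, hl⟩ := cube_bilayer_exists_near_ge (x - n₁) (y - n₂) (z - n₃) l₁ l₂ l₃
      (k - m) (by linarith) (by linarith) (by linarith) (by linarith) (by linarith) (by linarith)
      (by push_cast; linarith) (by push_cast; linarith) hD'
    refine ⟨a + n₁, b + n₂, c + n₃, ?_, ?_, ?_, ?_⟩
    · have : a + n₁ + (b + n₂) + (c + n₃) = (a + b + c) + (n₁ + n₂ + n₃) := by ring
      rw [this]; exact he.add ⟨m, hm⟩
    · omega
    · push_cast
      have e : (x - ((a:ℝ) + n₁)) ^ 2 + (y - ((b:ℝ) + n₂)) ^ 2 + (z - ((c:ℝ) + n₃)) ^ 2 =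
          (x - n₁ - a) ^ 2 + (y - n₂ - b) ^ 2 + (z - n₃ - c) ^ 2 := by ring
      rw [e]; exact hd
    · push_cast; linarith
  · -- point reflection `X ↦ (n₁+1, n₂+1, n₃+1) − X` (a symmetry of `D₃` mapping layers to layers)
    obtain ⟨m, hm⟩ := hodd
    have hD' : ∀ a b c : ℤ, Even (a + b + c) →
        ¬((a : ℝ) = n₁ + 1 - x ∧ (b : ℝ) = n₂ + 1 - y ∧ (c : ℝ) = n₃ + 1 - z) := by
      intro a b c he h
      refine hD (n₁ + 1 - a) (n₂ + 1 - b) (n₃ + 1 - c) ?_ ⟨?_, ?_, ?_⟩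
      · obtain ⟨r, hr⟩ := he
        exact ⟨m + 2 - r, by omega⟩
      · push_cast; linarith [h.1]
      · push_cast; linarith [h.2.1]
      · push_cast; linarith [h.2.2]
    have hm' : ((n₁ : ℝ) + n₂ + n₃) = 2 * (m : ℝ) + 1 := by
      have : ((n₁ + n₂ + n₃ : ℤ) : ℝ) = ((2 * m + 1 : ℤ) : ℝ) := by rw [hm]
      push_cast at this; linarith
    -- new slab index `k' = m + 1 - k`: `x'+y'+z' = (n₁+n₂+n₃+3) - (x+y+z) = 2m + 4 - (x+y+z)`
    obtain ⟨a, b, c, he, hl', hd, hl⟩ := cube_bilayer_exists_near_ge (n₁ + 1 - x) (n₂ + 1 - y) (n₃ + 1 - z)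
      (-l₁) (-l₂) (-l₃) (m + 1 - k) (by linarith) (by linarith) (by linarith) (by linarith) (by linarith)
      (by linarith) (by push_cast; linarith) (by push_cast; linarith) hD'
    refine ⟨n₁ + 1 - a, n₂ + 1 - b, n₃ + 1 - c, ?_, ?_, ?_, ?_⟩
    · obtain ⟨r, hr⟩ := he
      exact ⟨m + 2 - r, by omega⟩
    · omega
    · push_cast
      have e : (x - ((n₁:ℝ) + 1 - a)) ^ 2 + (y - ((n₂:ℝ) + 1 - b)) ^ 2 + (z - ((n₃:ℝ) + 1 - c)) ^ 2 =
          (n₁ + 1 - x - a) ^ 2 + (n₂ + 1 - y - b) ^ 2 + (n₃ + 1 - z - c) ^ 2 := by ring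
      rw [e]; exact hd
    · push_cast; linarith

/-- The same with the layer functional `−a + b + c` (the reflection `a ↦ −a` is a symmetry of `D₃`): this is the
layer index of the tree's cubic frame (`cubic_barlowPos`: the site `(k,i,j)` of `Λ₀` has cubic coordinates
`(i+j, i+k, j+k)`, so `−A+B+C = 2k`). -/
theorem D3_bilayer_exists_near_ge' (x y z l₁ l₂ l₃ : ℝ) (k : ℤ) (hlo : 2 * (k : ℝ) ≤ -x + y + z)
    (hhi : -x + y + z ≤ 2 * (k : ℝ) + 2)
    (hD : ∀ a b c : ℤ, Even (a + b + c) → ¬((a : ℝ) = x ∧ (b : ℝ) = y ∧ (c : ℝ) = z)) :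
    ∃ a b c : ℤ, Even (a + b + c) ∧ (-a + b + c = 2 * k ∨ -a + b + c = 2 * k + 2) ∧
      (x - a) ^ 2 + (y - b) ^ 2 + (z - c) ^ 2 < 2 ∧ l₁ * x + l₂ * y + l₃ * z ≤ l₁ * a + l₂ * b + l₃ * c := by
  have hD' : ∀ a b c : ℤ, Even (a + b + c) → ¬((a : ℝ) = -x ∧ (b : ℝ) = y ∧ (c : ℝ) = z) := by
    intro a b c he h
    refine hD (-a) b c ?_ ⟨?_, h.2.1, h.2.2⟩
    · obtain ⟨r, hr⟩ := he
      exact ⟨r - a, by omega⟩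
    · push_cast; linarith [h.1]
  obtain ⟨a, b, c, he, hl', hd, hl⟩ := D3_bilayer_exists_near_ge (-x) y z (-l₁) l₂ l₃ k (by linarith)
    (by linarith) hD'
  refine ⟨-a, b, c, ?_, by omega, ?_, ?_⟩
  · obtain ⟨r, hr⟩ := he
    exact ⟨r - a, by omega⟩
  · push_cast; nlinarith [hd]
  · push_cast; linarith

end Summit.Ventures.Crystal3D.Theorems
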